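import Mathlib
import Summits.ResolutionOfSingularities.ResolutionOfSingularities.Theorems.RadicialJungCleanModelsCleanProp44VeryNearAscent
import Summits.ResolutionOfSingularities.ResolutionOfSingularities.Theorems.RadicialJungCleanModelsCleanProp44Crossings
import Summits.ResolutionOfSingularities.ResolutionOfSingularities.Theorems.RadicialJungCleanModelsCleanSeqTauOneImage
import HarnessLib

/-!
# Route `RadicialJung`, crux `CleanModels` (stmt-ResolutionOfSingularities-15917), line `Sketch` rev 35, stub 6 `stub_cleanProp44` (X44c):
# X44c HOLDS whenever every `τ = 1` point of the `μ`-stratum is ISOLATED and has NO VERY NEAR POINT — unconditionally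

Seat decomp-res-hand-2 g15 (structural hand), capstone of the g15 chain (✓ `…TauTwoRegime`, `…TauTwoRegimeLocal`, `…TauOneVeryNear`,
`…VeryNearOpens`, `…VeryNearAscent`).  The regime **(I)**: every CLOSED threefold point `x` of the `μ`-stratum with Hironaka `τ_x = 1` is
(a) ISOLATED in `Σ = {ord J ≥ μ}` (no other point of `Σ` specialises to `x`) and (b) has NO VERY NEAR POINT (every blowing up of the stage at
`x` has `τ ≥ 2` at its closed threefold near points).  It contains the `τ ≥ 2` regime (no `τ = 1` point at all) and allows any finite number of
isolated `τ = 1` points next to arbitrary `τ ≥ 2` curves and points.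

* `IsCleanPermissibleSeq.isolatedTauOne_image` — **regime (I) is STABLE under clean-permissible sequences**: a new `τ = 1` closed threefold
  point `x''` lies over an old one `y` (✓ the one-step argument of `stalkTau_eq_one_image`); `y` cannot lie on the centre (an isolated point of
  the stratum on an irreducible centre inside the stratum IS the centre, and then `x''` is a near point of `y`, `τ ≥ 2` by (b) — contradiction);
  off the centre the blowing up is a local isomorphism: isolation transfers (✓ `IsBlowup.eq_of_apply_eq_of_not_mem`) and (b) ASCENDS
  (✓ `forall_near_two_le_of_isBlowup_of_not_mem`).
* `exists_isCleanPermissibleSeq_lt_of_isolatedTauOne` — **X44c's conclusion in regime (I)** (stage-free currency): clean Phase I ✓, regime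
  persists, no crossings (a crossing is a `τ = 1` point ON a curve, ✓ `stalkTau_eq_one_of_mem_closure_of_mem_closure`, not isolated), pieces ✓,
  the `τ = 1` point pieces by the no-very-near-point slice ✓ `exists_isCleanPermissibleSeq_lt_comap_of_isolated_of_forall_near_two_le`
  (the condition descended to the open, ✓ `forall_near_two_le_point_of_forall_near_two_le`), curves carry no `τ = 1` closed point, clean patching ✓.
* `cleanProp44_of_isolatedTauOne` — the same on the stages of `stub_cleanProp44` (binders verbatim + regime (I)).

So the τ = 1 residual of stub 6 is, by a kernel theorem, confined to: `τ = 1` points ON curves of the stratum, and `τ = 1` points WITH a very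
near point — the births world of memo 4e §2.4–2.6 ((R1), (R2ᵛⁿ′), (R3ᵛⁿ′) of ✓ `cleanProp44_of_tauOneResidualVN3`).

Honest framing: OURS; nothing here proves X44c in general, any case of `CleanModels`, or resolution of singularities in characteristic `p`.
[cite: CossartPiltant2008, Prop. 4.2 (b), Lemma 4.3, Lemma 4.5, Prop. 4.4 (proof, pp. 9–11)] [cite: Piltant2013, Prop. 5.1 (proof, Step 2)]
[cite: GortzWedhorn2020, Prop. 13.91]
-/

noncomputable section

set_option linter.dupNamespace false -- mandated namespace of this single-conjunct summit

open CategoryTheory CategoryTheory.Limits AlgebraicGeometry TopologicalSpace IsLocalRing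
open Literature.AlgebraicGeometry.Resolution Literature.AlgebraicGeometry.Motives
open Scheme.IdealSheafData
open Summit.ResolutionOfSingularities.ResolutionOfSingularities.Theorems.CP2008Prop44

namespace Summit.ResolutionOfSingularities.ResolutionOfSingularities.Theorems.RadicialJung.CleanModels

/-! ## §0 Plumbing -/

/-- For a point with regular local ring: embedding dimension `3` iff coheight `3`. [folklore] -/
private theorem spanFinrank_eq_three_iff_coheight₁ {X : Scheme.{0}} (x : X) [IsRegularLocalRing (X.presheaf.stalk x)] :
    (maximalIdeal (X.presheaf.stalk x)).spanFinrank = 3 ↔ Order.coheight x = 3 := by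
  have h := CampaignW46.coheight_eq_spanFinrank x
  constructor
  · intro hd
    rw [h, hd]
    rfl
  · intro hc
    rw [hc] at h
    exact_mod_cast h.symm

/-- Two points of coheight `2` one of which specialises to the other are equal. [folklore] -/
private theorem eq_of_specializes_of_coheight_eq_two₁ {X : Scheme.{0}} {ζ₁ ζ₂ : X} (h : ζ₁ ⤳ ζ₂)
    (h₁ : Order.coheight ζ₁ = 2) (h₂ : Order.coheight ζ₂ = 2) : ζ₁ = ζ₂ := by
  by_contra hne
  have hlt : ζ₂ < ζ₁ := ⟨h, fun h' => hne (h.antisymm h').eq⟩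
  have h3 := Order.coheight_add_one_le hlt
  rw [h₁, h₂] at h3
  exact absurd h3 (by decide)

/-- In the situation of `exists_isCleanPermissibleSeq_lt_of_pieces`: a point of order `≥ m` lies in `Z i` or outside `V i`. [folklore] -/
private theorem mem_or_not_mem_of_cover₁ {X : Scheme.{0}} {J : X.IdealSheafData} {m : ℕ} {n : ℕ} {Z : Fin n → Set X}
    (hcov : ∀ z : X, (m : ℕ∞) ≤ idealOrder J z → ∃ i, z ∈ Z i) (i : Fin n) (V : X.Opens)
    (hV : (V : Set X) = (⋃ j ∈ {j : Fin n | j ≠ i}, Z j)ᶜ) (z : X) (hz : (m : ℕ∞) ≤ idealOrder J z) :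
    z ∈ Z i ∨ z ∉ (V : Set X) := by
  obtain ⟨j, hj⟩ := hcov z hz
  by_cases hji : j = i
  · exact Or.inl (hji ▸ hj)
  · right
    rw [hV, Set.mem_compl_iff, not_not]
    exact Set.mem_iUnion₂.mpr ⟨j, hji, hj⟩

/-- A piece contained in `V i`. [folklore] -/
private theorem subset_of_cover₁ {X : Scheme.{0}} {n : ℕ} {Z : Fin n → Set X} (hdisj : ∀ i j, i ≠ j → Disjoint (Z i) (Z j))
    (i : Fin n) (V : X.Opens) (hV : (V : Set X) = (⋃ j ∈ {j : Fin n | j ≠ i}, Z j)ᶜ) : Z i ⊆ (V : Set X) := by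
  intro z hz
  rw [hV, Set.mem_compl_iff, Set.mem_iUnion₂]
  rintro ⟨j, hj, hzj⟩
  exact Set.disjoint_left.mp (hdisj i j (Ne.symm hj)) hz hzj

/-! ## §1 Regime (I) is stable under clean-permissible sequences -/

set_option maxHeartbeats 1600000 in
-- near-point bookkeeping at each step of the induction
/-- **Regime (I) — «every `τ = 1` closed threefold point of the `μ`-stratum is isolated in `Σ` and has no very near point» — propagates along
clean-permissible sequences.**  See the module docstring. [cite: CossartPiltant2008, Lemma 4.3, Prop. 4.2 (b)] [cite: GortzWedhorn2020, Prop. 13.91] -/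
theorem IsCleanPermissibleSeq.isolatedTauOne_image {p : ℕ} {X' X : Scheme.{0}} [IsIntegral X'] [IsIntegral X]
    {π : X' ⟶ X} [IsDominant π] {J : X.IdealSheafData} {μ : ℕ} {J' : X'.IdealSheafData} {G : X.functionField}
    (h : IsCleanPermissibleSeq p π J μ J' G) :
    IsNoetherian X → Scheme.IsRegular X → Scheme.IsQuasiExcellent X → topologicalKrullDim X ≤ 3 → 1 ≤ μ →
      (∀ x, idealOrder J x ≤ μ) → (∀ x ∈ J.support, 1 < Order.coheight x) →
      (∀ x : X, IsClosed ({x} : Set X) → idealOrder J x = μ → (maximalIdeal (X.presheaf.stalk x)).spanFinrank = 3 →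
        (∀ hr : IsRegularLocalRing (X.presheaf.stalk x), @stalkTau X J x hr μ = 1) →
        (∀ z : X, (μ : ℕ∞) ≤ idealOrder J z → z ⤳ x → z = x) ∧
        (∀ (hcl : IsClosed ({x} : Set X)) (X₂ : Scheme.{0}) (ϖ : X₂ ⟶ X), IsBlowup ϖ (vanishingIdeal ⟨{x}, hcl⟩) →
          ∀ w : X₂, IsClosed ({w} : Set X₂) → ϖ w = x → idealOrder (controlledTransform ϖ (vanishingIdeal ⟨{x}, hcl⟩) J μ) w = μ →
            (maximalIdeal (X₂.presheaf.stalk w)).spanFinrank = 3 →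
            ∀ hr : IsRegularLocalRing (X₂.presheaf.stalk w), 2 ≤ @stalkTau X₂ (controlledTransform ϖ (vanishingIdeal ⟨{x}, hcl⟩) J μ) w hr μ)) →
      ∀ x' : X', IsClosed ({x'} : Set X') → idealOrder J' x' = μ → (maximalIdeal (X'.presheaf.stalk x')).spanFinrank = 3 →
        (∀ hr : IsRegularLocalRing (X'.presheaf.stalk x'), @stalkTau X' J' x' hr μ = 1) →
        (∀ z : X', (μ : ℕ∞) ≤ idealOrder J' z → z ⤳ x' → z = x') ∧
        (∀ (hcl : IsClosed ({x'} : Set X')) (X₂ : Scheme.{0}) (ϖ : X₂ ⟶ X'), IsBlowup ϖ (vanishingIdeal ⟨{x'}, hcl⟩) →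
          ∀ w : X₂, IsClosed ({w} : Set X₂) → ϖ w = x' → idealOrder (controlledTransform ϖ (vanishingIdeal ⟨{x'}, hcl⟩) J' μ) w = μ →
            (maximalIdeal (X₂.presheaf.stalk w)).spanFinrank = 3 →
            ∀ hr : IsRegularLocalRing (X₂.presheaf.stalk w), 2 ≤ @stalkTau X₂ (controlledTransform ϖ (vanishingIdeal ⟨{x'}, hcl⟩) J' μ) w hr μ) := by
  induction h with
  | nil J μ G => intro _ _ _ _ _ _ _ hP; exact hP
  | @cons X'' X' X _ _ _ τ _ π _ J μ J' G Y hπ hint hreg hY hτ hperm ih =>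
    intro hN hX hqe hX3 hμ hle hcodim hP x'' hx''cl hord'' hd'' hτ1
    haveI := hN
    have IH := ih hN hX hqe hX3 hμ hle hcodim hP
    -- the invariants at the intermediate stage `X'`
    obtain ⟨-, hnoeth', hX', -, hle', hcodim'⟩ :=
      IsPermissibleBlowupSeq.prop44Invariants hX hqe hμ hle hcodim (isPermissibleBlowupSeq_of_isPermissibleSeq hπ.isPermissibleSeq)
    haveI := hnoeth'
    have hX3' : topologicalKrullDim X' ≤ 3 :=
      (isPermissibleBlowupSeq_of_isPermissibleSeq hπ.isPermissibleSeq).topologicalKrullDim_le inferInstance hX3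
    have hcoh3' : ∀ z : X', Order.coheight z ≤ 3 := (topologicalKrullDim_le_iff_forall_coheight_le X' 3).mp hX3'
    haveI : IsProper τ := hτ.isProper
    haveI : IsLocallyNoetherian X'' := hτ.isLocallyNoetherian
    haveI hry : IsRegularLocalRing (X'.presheaf.stalk (τ x'')) := hX' (τ x'')
    haveI hrx : IsRegularLocalRing (X''.presheaf.stalk x'') := (hτ.isRegular_of_isRegular_subscheme hX' hreg) x''
    -- the image point `τ x''` is closed, of embedding dimension `3`
    have hycl : IsClosed ({τ x''} : Set X') := by
      have := τ.isClosedMap _ hx''cl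
      rwa [Set.image_singleton] at this
    have hcohx'' : Order.coheight x'' = 3 := (spanFinrank_eq_three_iff_coheight₁ x'').mp hd''
    have hcohy : Order.coheight (τ x'') = 3 := le_antisymm (hcoh3' _) (hcohx'' ▸ hτ.coheight_le x'')
    have hdy : (maximalIdeal (X'.presheaf.stalk (τ x''))).spanFinrank = 3 := (spanFinrank_eq_three_iff_coheight₁ _).mpr hcohy
    have hnear : IsNear τ (vanishingIdeal Y) J' μ x'' := isNear_iff.mpr hord''
    by_cases hmem : τ x'' ∈ (Y : Set X')
    · -- over the centre: impossible in regime (I)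
      exfalso
      have hordy : idealOrder J' (τ x'') = μ := hY _ hmem
      -- the generic point of the (irreducible) centre
      have hirr : IsIrreducible (Y : Set X') := isIrreducible_of_isIntegral_subscheme_vanishingIdeal Y hint
      obtain ⟨η, hη⟩ := QuasiSober.sober hirr Y.isClosed
      have hYeq : (Y : Set X') = closure {η} := (isGenericPoint_def.mp hη).symm
      have hηY : η ∈ (Y : Set X') := hη.mem
      -- `τ(τ x'') = 1`: if `τ ≥ 2`, a point centre gives `τ(x'') ≥ 2`, a curve centre gives no near point
      have hτy : stalkTau J' (τ x'') μ = 1 := by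
        refine le_antisymm ?_ (one_le_stalkTau J' (τ x'') hμ hordy)
        by_contra hτy
        rw [not_le] at hτy
        have hτy2 : 2 ≤ stalkTau J' (τ x'') μ := hτy
        by_cases hηy : η = τ x''
        · have hYpt : (Y : Set X') = {τ x''} := by rw [hYeq, hηy, hycl.closure_eq]
          have hYc : Y = ⟨{τ x''}, hycl⟩ := Closeds.ext hYpt
          obtain ⟨c3, hc3, hc3Y⟩ := CampaignW46.exists_rsop_three hycl hdy
          rw [← hYc] at hc3Y
          have hle2 : stalkTau J' (τ x'') μ ≤ 2 := hτ.stalkTau_le_two_of_isNear_point hdy hc3 hc3Y hnear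
          have hτyeq : stalkTau J' (τ x'') μ = 2 := le_antisymm hle2 hτy2
          have hmono := hτ.stalkTau_le_stalkTau_of_isNear_point hμ hdy hc3 hc3Y hτyeq hnear
          rw [hτyeq, hτ1 hrx] at hmono
          exact absurd hmono (by decide)
        · have hηy' : η ⤳ τ x'' := specializes_iff_mem_closure.mpr (hYeq ▸ hmem)
          have hyη : ¬ τ x'' ⤳ η := fun h' => hηy (hηy'.antisymm h').eq
          have hηsupp : η ∈ J'.support := by
            rw [← one_le_idealOrder_iff, hY η hηY]
            exact_mod_cast hμ
          have h1 : 1 < Order.coheight η := hcodim' η hηsupp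
          obtain ⟨c, hcr, hcY⟩ := exists_isRsopPart_fin_two_of_specializes hreg hYeq hηy' hyη h1 (hcoh3' _)
          exact hτ.not_isNear_of_two_le_stalkTau hX' hreg hμ hY hcr hcY hτy2 hnear
      -- regime (I) at `τ x''`: isolated; hence the centre IS the point, and `x''` is a near point with `τ = 1` — contradiction with (b)
      obtain ⟨hisoy, hvny⟩ := IH (τ x'') hycl hordy hdy (fun hr => hτy)
      have hηeq : η = τ x'' :=
        hisoy η (by rw [hY η hηY]) (specializes_iff_mem_closure.mpr (hYeq ▸ hmem))
      have hYpt : (Y : Set X') = {τ x''} := by rw [hYeq, hηeq, hycl.closure_eq]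
      have hYc : Y = ⟨{τ x''}, hycl⟩ := Closeds.ext hYpt
      subst hYc
      have h2 := hvny hycl X'' τ hτ x'' hx''cl rfl hord'' hd'' hrx
      have h1 := hτ1 hrx
      omega
    · -- off the centre: the local ring, the order and `τ` are those of the image point; regime (I) there, transported
      have hnot : τ x'' ∉ ((vanishingIdeal Y).support : Set X') := by
        rwa [Scheme.IdealSheafData.coe_support_vanishingIdeal]
      have hτeq := hτ.stalkTau_controlledTransform_of_not_mem J' μ μ hnot (x' := x'')
      have hordeq := hτ.idealOrder_controlledTransform_of_not_mem J' μ hnot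
      have hordy : idealOrder J' (τ x'') = μ := by rw [← hordeq]; exact hord''
      have hτy : stalkTau J' (τ x'') μ = 1 := by rw [← hτeq]; exact hτ1 hrx
      obtain ⟨hisoy, hvny⟩ := IH (τ x'') hycl hordy hdy (fun hr => hτy)
      refine ⟨fun z hz hsp => ?_, fun hcl'' X₂ ϖ hϖ w hwcl hw hordw hdw hrw => ?_⟩
      · -- (a) isolation transfers along the local isomorphism
        have hspz : τ z ⤳ τ x'' := hsp.map τ.continuous
        by_cases hzY : τ z ∈ (Y : Set X')
        · exfalso
          apply hmem
          exact Y.isClosed.closure_subset_iff.mpr (Set.singleton_subset_iff.mpr hzY) (specializes_iff_mem_closure.mp hspz)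
        · have hnotz : τ z ∉ ((vanishingIdeal Y).support : Set X') := by
            rwa [Scheme.IdealSheafData.coe_support_vanishingIdeal]
          have hordz : (μ : ℕ∞) ≤ idealOrder J' (τ z) := by
            rw [← hτ.idealOrder_controlledTransform_of_not_mem J' μ hnotz]
            exact hz
          have heq : τ z = τ x'' := hisoy (τ z) hordz hspz
          exact CampaignW46.IsBlowup.eq_of_apply_eq_of_not_mem hτ heq hnotz
      · -- (b) «no very near point» ascends along the blowing up `τ` away from `τ x''`
        exact forall_near_two_le_of_isBlowup_of_not_mem hX3' hτ J' μ (τ x'') hycl hmem x'' rfl hcl'' (hvny hycl)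
          X₂ ϖ hϖ w hwcl hw hordw hdw hrw

/-! ## §2 X44c in regime (I) -/

set_option maxHeartbeats 1600000 in
-- the piece analysis has five branches
/-- **X44c's conclusion in regime (I)** (stage-free currency): `X` integral Noetherian regular quasi-excellent of dimension `≤ 3`, `char K(X) = p`,
the line of `G` clean-regular at every point; `(J, μ)` with `μ ≥ 1`, `ord ≤ μ`, `V(J)` of codimension `≥ 2`; every `τ = 1` closed threefold point of the
`μ`-stratum isolated in `Σ` and without very near point.  Then some CLEAN-permissible sequence brings `ord` below `μ` everywhere.
[cite: CossartPiltant2008, Prop. 4.4 (proof, pp. 9–11), Lemma 4.3, Lemma 4.5] [cite: Piltant2013, Prop. 5.1 (proof, Step 2)] -/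
theorem exists_isCleanPermissibleSeq_lt_of_isolatedTauOne {p : ℕ} (hp : p.Prime) {X : Scheme.{0}} [IsIntegral X] [IsNoetherian X]
    [hcharX : CharP X.functionField p] (hX : Scheme.IsRegular X) (hqe : Scheme.IsQuasiExcellent X) (hX3 : topologicalKrullDim X ≤ 3)
    (G : X.functionField) (hG : ∀ x : X, CleanRegAt p (algebraMap (X.presheaf.stalk x) X.functionField) G)
    (J : X.IdealSheafData) {μ : ℕ} (hμ : 1 ≤ μ) (hle : ∀ z, idealOrder J z ≤ μ) (hcodim : ∀ z ∈ J.support, 1 < Order.coheight z)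
    (hI : ∀ x : X, IsClosed ({x} : Set X) → idealOrder J x = μ → (maximalIdeal (X.presheaf.stalk x)).spanFinrank = 3 →
      (∀ hr : IsRegularLocalRing (X.presheaf.stalk x), @stalkTau X J x hr μ = 1) →
      (∀ z : X, (μ : ℕ∞) ≤ idealOrder J z → z ⤳ x → z = x) ∧
      (∀ (hcl : IsClosed ({x} : Set X)) (X₂ : Scheme.{0}) (ϖ : X₂ ⟶ X), IsBlowup ϖ (vanishingIdeal ⟨{x}, hcl⟩) →
        ∀ w : X₂, IsClosed ({w} : Set X₂) → ϖ w = x → idealOrder (controlledTransform ϖ (vanishingIdeal ⟨{x}, hcl⟩) J μ) w = μ →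
          (maximalIdeal (X₂.presheaf.stalk w)).spanFinrank = 3 →
          ∀ hr : IsRegularLocalRing (X₂.presheaf.stalk w), 2 ≤ @stalkTau X₂ (controlledTransform ϖ (vanishingIdeal ⟨{x}, hcl⟩) J μ) w hr μ)) :
    ∃ (X' : Scheme.{0}) (π : X' ⟶ X) (_ : IsIntegral X') (_ : IsDominant π) (J' : X'.IdealSheafData),
      IsCleanPermissibleSeq p π J μ J' G ∧ ∀ x, idealOrder J' x < μ := by
  -- Phase I (clean, ✓): a stage without bad points
  obtain ⟨X₁, Φ, hint₁', hΦ, J₁, hseq, hRT⟩ := exists_cleanSeq_regular_transverse hp hX hqe hX3 G hG J hμ hle hcodim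
  haveI := hint₁'
  haveI := hΦ
  have hseqW : CampaignW46.IsPermissibleBlowupSeq J μ Φ J₁ :=
    CP2008Prop44.isPermissibleBlowupSeq_of_isPermissibleSeq hseq.isPermissibleSeq
  obtain ⟨-, hnoeth₁, hX₁, hqe₁, hle₁, hcodim₁⟩ := IsPermissibleBlowupSeq.prop44Invariants hX hqe hμ hle hcodim hseqW
  haveI := hnoeth₁
  have hX3₁ : topologicalKrullDim X₁ ≤ 3 := hseqW.topologicalKrullDim_le inferInstance hX3
  have hG₁ : ∀ x : X₁, IsGRing (X₁.presheaf.stalk x) := fun x => Scheme.isGRing_stalk_of_isQuasiExcellent hqe₁ x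
  haveI hcharX₁ : CharP X₁.functionField p := charP_of_injective_ringHom (RatFn.functionFieldMap Φ).injective p
  have hcoh3 : ∀ z : X₁, Order.coheight z ≤ 3 := (topologicalKrullDim_le_iff_forall_coheight_le X₁ 3).mp hX3₁
  have hG₁' : ∀ x : X₁, CleanRegAt p (algebraMap (X₁.presheaf.stalk x) X₁.functionField) (RatFn.functionFieldMap Φ G) :=
    hseq.cleanRegAt hp hcharX hG
  -- regime (I) PERSISTS at the reached stage
  have hI₁ := hseq.isolatedTauOne_image inferInstance hX hqe hX3 hμ hle hcodim hI
  -- `τ ≥ 2` at every closed threefold point of the stratum lying on a curve of `Σ`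
  have hcurveτ : ∀ (ζ y : X₁), (μ : ℕ∞) ≤ idealOrder J₁ ζ → ¬ IsClosed ({ζ} : Set X₁) → ζ ⤳ y → IsClosed ({y} : Set X₁) →
      idealOrder J₁ y = μ → (maximalIdeal (X₁.presheaf.stalk y)).spanFinrank = 3 →
      ∀ hr : IsRegularLocalRing (X₁.presheaf.stalk y), 2 ≤ @stalkTau X₁ J₁ y hr μ := by
    intro ζ y hζ hζcl hζy hycl hordy hdy hr
    by_contra hlt
    rw [not_le] at hlt
    have h1 : 1 ≤ @stalkTau X₁ J₁ y hr μ := one_le_stalkTau J₁ y hμ hordy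
    have hτ1 : ∀ hr' : IsRegularLocalRing (X₁.presheaf.stalk y), @stalkTau X₁ J₁ y hr' μ = 1 := fun hr' => by
      have : @stalkTau X₁ J₁ y hr μ = 1 := by omega
      exact this
    have hiso := (hI₁ y hycl hordy hdy hτ1).1
    have heq : ζ = y := hiso ζ hζ hζy
    exact hζcl (heq ▸ hycl)
  -- the stage is TIDY: curves of `Σ` regular (no bad point) and pairwise disjoint (a common point is a `τ = 1` point on a curve)
  have htidy_reg : ∀ ζ : X₁, (μ : ℕ∞) ≤ idealOrder J₁ ζ → Order.coheight ζ = 2 → ¬ IsClosed ({ζ} : Set X₁) →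
      Scheme.IsRegular (vanishingIdeal (⟨closure {ζ}, isClosed_closure⟩ : Closeds X₁)).subscheme :=
    fun ζ hζ hcoh hcl => (curve_of_noBad hX₁ hX3₁ J₁ hμ hle₁ hcodim₁ (𝒞 := {C : Closeds X₁ | _}) (fun C => Iff.rfl) hRT
      ⟨ζ, mem_maxPoints_setOf_of_coheight_eq_two hμ hcoh3 hcodim₁ hζ hcoh, hcl, rfl⟩).1
  have htidy_disj : ∀ ζ₁ ζ₂ : X₁, (μ : ℕ∞) ≤ idealOrder J₁ ζ₁ → Order.coheight ζ₁ = 2 → ¬ IsClosed ({ζ₁} : Set X₁) →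
      (μ : ℕ∞) ≤ idealOrder J₁ ζ₂ → Order.coheight ζ₂ = 2 → ¬ IsClosed ({ζ₂} : Set X₁) → ζ₁ ≠ ζ₂ →
      Disjoint (closure ({ζ₁} : Set X₁)) (closure {ζ₂}) := by
    intro ζ₁ ζ₂ hζ₁ hc₁ hn₁ hζ₂ hc₂ hn₂ hne
    rw [Set.disjoint_iff]
    rintro q ⟨hq₁, hq₂⟩
    obtain ⟨hqcl, hcohq, hordq, hτq⟩ := stalkTau_eq_one_of_mem_closure_of_mem_closure hX₁ hqe₁ hX3₁ J₁ hμ hle₁ hcodim₁ hζ₁ hc₁ hζ₂ hc₂ hne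
      (htidy_reg ζ₁ hζ₁ hc₁ hn₁) hq₁ hq₂
    haveI hrq : IsRegularLocalRing (X₁.presheaf.stalk q) := hX₁ q
    have hdq : (maximalIdeal (X₁.presheaf.stalk q)).spanFinrank = 3 := (spanFinrank_eq_three_iff_coheight₁ q).mpr hcohq
    have h2 := hcurveτ ζ₁ q hζ₁ hn₁ (specializes_iff_mem_closure.mpr hq₁) hqcl hordq hdq hrq
    have h1 := hτq hrq
    omega
  -- the pieces of the tidy stage (✓)
  obtain ⟨n, Z, hZc, hdisj, hcov, hkind⟩ := exists_pieces_of_tidy hX₁ hqe₁ hX3₁ J₁ hμ hle₁ hcodim₁ htidy_reg htidy_disj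
  have hred : ∃ (X' : Scheme.{0}) (π : X' ⟶ X₁) (_ : IsIntegral X') (_ : IsDominant π) (J' : X'.IdealSheafData),
      IsCleanPermissibleSeq p π J₁ μ J' (RatFn.functionFieldMap Φ G) ∧ ∀ x, idealOrder J' x < μ := by
    refine exists_isCleanPermissibleSeq_lt_of_pieces J₁ μ (RatFn.functionFieldMap Φ G) Z hZc hdisj hcov fun i V hV => ?_
    intro hVint hVdom
    have hbad := mem_or_not_mem_of_cover₁ hcov i V hV
    have hZV := subset_of_cover₁ hdisj i V hV
    -- a closed threefold point piece `{x}` of the stratum, any `τ`: the no-very-near slice at `τ = 1`, the `τ ≥ 2` slice otherwise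
    have hpoint : ∀ x : X₁, Z i = {x} → idealOrder J₁ x = μ → (maximalIdeal (X₁.presheaf.stalk x)).spanFinrank = 3 →
        ∃ (V' : Scheme.{0}) (π : V' ⟶ V) (_ : IsIntegral V') (_ : IsDominant π) (K' : V'.IdealSheafData),
          IsCleanPermissibleSeq p π (J₁.comap V.ι) μ K' (RatFn.functionFieldMap V.ι (RatFn.functionFieldMap Φ G)) ∧
            ∀ y, idealOrder K' y < μ := by
      intro x hZ hord hdim
      have hxV : x ∈ V := hZV (by rw [hZ]; exact Set.mem_singleton x)
      have hcl : IsClosed ({x} : Set X₁) := hZ ▸ hZc i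
      have hbad' : ∀ z : X₁, (μ : ℕ∞) ≤ idealOrder J₁ z → z = x ∨ z ∉ (V : Set X₁) :=
        fun z hz => (hbad z hz).imp (fun h => by rw [hZ] at h; exact h) id
      haveI hrx : IsRegularLocalRing (X₁.presheaf.stalk x) := hX₁ x
      by_cases hτ2 : 2 ≤ stalkTau J₁ x μ
      · exact exists_isCleanPermissibleSeq_lt_comap_of_isolated_two_le_tau hp hX₁ J₁ hμ (RatFn.functionFieldMap Φ G) hG₁' V x hxV hcl
          hbad' hord hdim hτ2 (hG₁ x)
      · have h1 : 1 ≤ stalkTau J₁ x μ := one_le_stalkTau J₁ x hμ hord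
        have hτ1 : ∀ hr : IsRegularLocalRing (X₁.presheaf.stalk x), @stalkTau X₁ J₁ x hr μ = 1 := fun hr => by
          have : @stalkTau X₁ J₁ x hrx μ = 1 := by omega
          exact this
        have hvn := (hI₁ x hcl hord hdim hτ1).2 hcl
        exact exists_isCleanPermissibleSeq_lt_comap_of_isolated_of_forall_near_two_le hp hX₁ hqe₁ hX3₁ (RatFn.functionFieldMap Φ G) hG₁' J₁
          hμ hle₁ hcodim₁ V x hxV hbad' hord hdim (forall_near_two_le_point_of_forall_near_two_le hX3₁ J₁ μ V x hxV hcl hvn)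
    rcases hkind i with ⟨x, hZ, hord, hdim, -⟩ | ⟨x, hZ, hord, hdim, -⟩ | ⟨x, hZ, hord, hcoh⟩ | ⟨Y, hZ, hreg, hirr, hordY, hcurveY⟩
    · exact hpoint x hZ hord hdim
    · exact hpoint x hZ hord hdim
    · -- coheight-2 point: the CLEAN local-dimension-two slice
      have hxV : x ∈ V := hZV (by rw [hZ]; exact Set.mem_singleton x)
      have hcl : IsClosed ({x} : Set X₁) := hZ ▸ hZc i
      exact exists_isCleanPermissibleSeq_lt_comap_of_isolated_coheight_two hp hX₁ J₁ hμ hle₁ hcodim₁ (RatFn.functionFieldMap Φ G) hG₁'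
        V x hxV hcl (fun z hz => (hbad z hz).imp (fun h => by rw [hZ] at h; exact h) id) hord hcoh
    · -- regular irreducible piece `Y` of the stratum: its generic point `η`
      obtain ⟨η, hη⟩ := QuasiSober.sober hirr Y.isClosed
      have hYeq : (Y : Set X₁) = closure {η} := (isGenericPoint_def.mp hη).symm
      have hηY : η ∈ (Y : Set X₁) := hη.mem
      have hordη : idealOrder J₁ η = μ := hordY η hηY
      have hηsupp : η ∈ J₁.support := by
        rw [← one_le_idealOrder_iff, hordη]
        exact_mod_cast hμ
      have h1η : 1 < Order.coheight η := hcodim₁ η hηsupp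
      by_cases hηcl : IsClosed ({η} : Set X₁)
      · -- degenerate piece `Y = {η}`
        have hYpt : (Y : Set X₁) = {η} := by rw [hYeq, hηcl.closure_eq]
        by_cases hcohη : Order.coheight η = 3
        · haveI hrη : IsRegularLocalRing (X₁.presheaf.stalk η) := hX₁ η
          exact hpoint η (hZ.trans hYpt) hordη ((spanFinrank_eq_three_iff_coheight₁ η).mpr hcohη)
        · have hηV : η ∈ V := hZV (by rw [hZ]; exact hηY)
          have hbad' : ∀ z : X₁, (μ : ℕ∞) ≤ idealOrder J₁ z → z = η ∨ z ∉ (V : Set X₁) :=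
            fun z hz => (hbad z hz).imp (fun h => by rw [hZ, hYpt] at h; exact h) id
          have hcoh2 : Order.coheight η = 2 := by
            have h3 := hcoh3 η
            generalize hc : Order.coheight η = c at h1η h3 hcohη
            induction c using ENat.recTopCoe with
            | top => exact absurd h3 (by simp)
            | coe m =>
              have h1' : 1 < m := by exact_mod_cast h1η
              have h3' : m ≤ 3 := by exact_mod_cast h3
              have hne3 : m ≠ 3 := fun h => hcohη (by rw [h]; rfl)
              have : m = 2 := by omega
              rw [this]
              rfl
          exact exists_isCleanPermissibleSeq_lt_comap_of_isolated_coheight_two hp hX₁ J₁ hμ hle₁ hcodim₁ (RatFn.functionFieldMap Φ G)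
            hG₁' V η hηV hηcl hbad' hordη hcoh2
      · -- a genuine curve: its closed points are threefold points of the stratum lying on a curve, so `τ ≥ 2` there
        have hall : ∀ y ∈ (Y : Set X₁), IsClosed ({y} : Set X₁) → haveI := hX₁ y; 2 ≤ stalkTau J₁ y μ := by
          intro y hy hycl
          have hηy : η ⤳ y := specializes_iff_mem_closure.mpr (hYeq ▸ hy)
          have hyη : ¬ y ⤳ η := fun h' => hηcl (by rw [(hηy.antisymm h').eq]; exact hycl)
          obtain ⟨-, hcohy⟩ := coheight_eq_two_of_specializes hηy hyη h1η (hcoh3 y)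
          haveI hry : IsRegularLocalRing (X₁.presheaf.stalk y) := hX₁ y
          have hdy : (maximalIdeal (X₁.presheaf.stalk y)).spanFinrank = 3 := (spanFinrank_eq_three_iff_coheight₁ y).mpr hcohy
          exact hcurveτ η y (by rw [hordη]) hηcl hηy hycl (hordY y hy) hdy (hX₁ y)
        exact exists_isCleanPermissibleSeq_lt_comap_of_curve_two_le_tau hp hX₁ hqe₁ hX3₁ (RatFn.functionFieldMap Φ G) hG₁' J₁ hμ hle₁ V Y hirr
          (hZ ▸ hZV) (fun z hz => (hbad z hz).imp (fun h => by rw [hZ] at h; exact h) id) hordY (fun y hy => hcurveY y hy (hX₁ y)) hall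
  -- compose with the Phase I sequence
  obtain ⟨X', π, hX', hπ, J', hseq', hlt⟩ := hred
  haveI := hX'
  haveI := hπ
  exact ⟨X', π ≫ Φ, inferInstance, inferInstance, J', hseq.comp hseq' rfl, hlt⟩

end Summit.ResolutionOfSingularities.ResolutionOfSingularities.Theorems.RadicialJung.CleanModels

end
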